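import Literature.IUT.LogVolume.Remark171Weights
import HarnessLib

/-!
# [IUTchIII] Rmk 3.1.1 (ii) weights at an ARCHIMEDEAN `v_ℚ` against [AbsTopIII] Prop 5.7 (ii)'s RADIAL
# log-volume: the weights sum to `1/2`, so "×e ↦ +1" needs the [IUTchIV] Rmk 1.7.1 normalized weights
# (proof-only companion to `PacketWeights.lean` / `Remark171Weights.lean`, abc-iut cell, advisory d035-A2)

Sources read on the page. [AbsTopIII] Prop 5.7 (ii)(a)(b), kurims p. 138 (`paper:url-5493eb38cbb7`): for a
complex archimedean field `k` the RADIAL volume is the length of `pr_ℝ(A)` for "the standard `ℝ`-valued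
absolute value", `μ_k(𝒪_k) = 1`, `μ̇_k(x) = μ_k(x·𝒪_k)`, `μ^log_k(x·A) = μ^log_k(A) + μ̇^log_k(x)` — so
`μ̇_k(x) = |x|` and multiplication by `e` adds `1` per complex field (tree: `radialUnitVolume_eq_norm`,
`radialLogVolume_smul`, abc-iut-L4-t3/S2). [IUTchIII] Rmk 3.1.1 (ii) p. 94: the normalized weight of the
summand `K_v` of `log(^α𝓕_{v_ℚ})` is `1/([K_v:(F_mod)_v] · Σ_{w|v_ℚ} [(F_mod)_w:ℚ_{v_ℚ}])` (tree:
`packetWeight degF degKF`), "normalized so that multiplication by `p_{v_ℚ}` affects log-volumes by addition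
or subtraction … of `log(p_{v_ℚ})`"; Prop 3.9 (i) p. 116 (archimedean): "the sum of the radial log-volumes
… normalized weights … multiplication … by `e = 2.71828…` corresponds to adding the quantity `1 = log(e)`".
[IUTchIV] Rmk 1.7.1 p. 17: the weights of Rmk 3.1.1 (ii) "were computed relative to the non-normalized
log-volumes of [AbsTopIII], Proposition 5.8, (iii), (vi)"; with NORMALIZED log-volumes they "must be
replaced" by `[K_v:ℚ_{v_ℚ}]·[K_v:(F_mod)_v]^{-1} = [(F_mod)_v:ℚ_{v_ℚ}]` (tree: `normalizedTensorWeight`,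
`packetWeight_mul_localDegree`).

At `v_ℚ = ∞` every `K_v` is `ℂ` (the fields `K ⊇ F ∋ √−1` of [IUTchI] Def 3.1 are totally complex), so
`[K_v:(F_mod)_v]·[(F_mod)_v:ℝ] = [ℂ:ℝ] = 2` for every `v | ∞`. THIS FILE PROVES the bookkeeping consequence:
under that hypothesis the Rmk 3.1.1 (ii) weights over `v | ∞` SUM TO `1/2` (`sum_packetWeight_eq_half`),
hence pairing them with a per-field log-volume that changes by `c` under `×e` changes the weighted sum by
`c/2` (`sum_packetWeight_mul_const_eq_half`) — with the RADIAL log-volume (`c = 1`) that is `+1/2`, NOT the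
printed `+1`; whereas the [IUTchIV] Rmk 1.7.1 normalized weights `[(F_mod)_v:ℝ]/[F_mod:ℚ]` give exactly `c`
(`sum_normalizedWeight_mul_const`), and the Rmk 3.1.1 (ii) weights give `+1` precisely when the per-field
log-volume scales by `[K_v:ℝ]·c = 2c` (`sum_packetWeight_mul_localDegree_const`) — the "non-normalized" reading
of [IUTchIV] Rmk 1.7.1. Also the `A`-fold tensor version of the weight sum: `(1/2)^{|A|}`
(`sum_packetWeightTensor_eq_half_pow`).

READING (neutral; no landed file is affected — the archimedean weights are RESIDUAL binders in
abc-iut-c312-5's `LocalPieces` / abc-iut-c312-6's `FrameVolumePieces`): [AbsTopIII]'s radial log-volume is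
already the `ℝ`-dimension-normalized archimedean log-volume, so it must be paired with the Rmk 1.7.1
weights (`normalizedTensorWeight`); Rmk 3.1.1 (ii)'s `packetWeight`/`packetWeightTensor` go with `[K_v:ℝ]×`
the radial log-volume. Elementary finite sums; [claim: Mochizuki2012, status: disputed] for the quoted
conventions. Nothing here bears on [IUTchIII] Cor. 3.12.
-/

namespace Literature.IUT.LogThetaLattice

open Finset Literature.IUT.LogVolume

universe u v

section ArchimedeanHalf

variable {W : Type u} [Fintype W] [Nonempty W]

/-- A nonempty sum of positive degrees is nonzero. [folklore] -/
private lemma sum_degF_ne_zero (degF : W → ℕ+) : (∑ w, (degF w : ℝ)) ≠ 0 :=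
  (Finset.sum_pos (fun w _ => by exact_mod_cast (degF w).pos) Finset.univ_nonempty).ne'

/-- Under `[K_v:(F_mod)_v]·[(F_mod)_v:ℝ] = 2` (all `K_v = ℂ`): the Rmk 3.1.1 (ii) weight at `v` is
`[(F_mod)_v:ℝ] / (2·[F_mod:ℚ])`, i.e. HALF the [IUTchIV] Rmk 1.7.1 normalized weight
([IUTchIII] Rmk 3.1.1 (ii) p.94; [IUTchIV] Rmk 1.7.1 p.17). [claim: Mochizuki2012, status: disputed] -/
theorem packetWeight_eq_half_normalized (degF degKF : W → ℕ+)
    (h2 : ∀ w, (degKF w : ℝ) * (degF w : ℝ) = 2) (w : W) :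
    packetWeight degF degKF w = (degF w : ℝ) / (2 * ∑ w', (degF w' : ℝ)) := by
  have hD := sum_degF_ne_zero degF
  have hk : (degKF w : ℝ) ≠ 0 := by exact_mod_cast (degKF w).pos.ne'
  have hw := h2 w
  unfold packetWeight
  rw [div_eq_div_iff (mul_ne_zero hk hD) (mul_ne_zero two_ne_zero hD)]
  calc (1 : ℝ) * (2 * ∑ w', (degF w' : ℝ)) = ((degKF w : ℝ) * (degF w : ℝ)) * ∑ w', (degF w' : ℝ) := by
        rw [hw]; ring
    _ = (degF w : ℝ) * ((degKF w : ℝ) * ∑ w', (degF w' : ℝ)) := by ring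

/-- **The Rmk 3.1.1 (ii) weights over an archimedean `v_ℚ` sum to `1/2`** when every `K_v` is `ℂ`
(`[K_v:(F_mod)_v]·[(F_mod)_v:ℝ] = 2`): `Σ_{v|∞} 1/([K_v:(F_mod)_v]·[F_mod:ℚ]) = Σ_v [(F_mod)_v:ℝ]/(2[F_mod:ℚ]) = 1/2`
([IUTchIII] Rmk 3.1.1 (ii) p.94, with `Σ_{w|∞} [(F_mod)_w:ℝ] = [F_mod:ℚ]`). [claim: Mochizuki2012, status: disputed] -/
theorem sum_packetWeight_eq_half (degF degKF : W → ℕ+) (h2 : ∀ w, (degKF w : ℝ) * (degF w : ℝ) = 2) :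
    ∑ w, packetWeight degF degKF w = 1 / 2 := by
  have hD := sum_degF_ne_zero degF
  simp_rw [packetWeight_eq_half_normalized degF degKF h2, ← Finset.sum_div]
  field_simp

/-- Hence, if the per-field archimedean log-volume changes by `c` under multiplication by `e` — `c = 1` for
[AbsTopIII] Prop 5.7 (ii)'s RADIAL log-volume (`μ̇_k(x) = |x|`, p.138) — the Rmk 3.1.1 (ii)-weighted sum
changes by `c/2`, not by the `1 = log(e)` of [IUTchIII] Prop 3.9 (i) p.116. [claim: Mochizuki2012, status: disputed] -/
theorem sum_packetWeight_mul_const_eq_half (degF degKF : W → ℕ+)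
    (h2 : ∀ w, (degKF w : ℝ) * (degF w : ℝ) = 2) (c : ℝ) :
    ∑ w, packetWeight degF degKF w * c = c / 2 := by
  rw [← Finset.sum_mul, sum_packetWeight_eq_half degF degKF h2]
  ring

/-- … whereas with a per-field log-volume scaling by `[K_v:ℝ]·c = [K_v:(F_mod)_v]·[(F_mod)_v:ℝ]·c` (the
"non-normalized" archimedean log-volume in the sense of [IUTchIV] Rmk 1.7.1) the Rmk 3.1.1 (ii)-weighted
change is exactly `c` — abc-iut-L6-t4's `packetWeight_normalized`, recorded here for contrast.
[claim: Mochizuki2012, status: disputed] -/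
theorem sum_packetWeight_mul_localDegree_const (degF degKF : W → ℕ+) (c : ℝ) :
    ∑ w, packetWeight degF degKF w * (((degKF w : ℝ) * (degF w : ℝ)) * c) = c :=
  packetWeight_normalized degF degKF c

/-- **The [IUTchIV] Rmk 1.7.1 normalized weights are the right partner of the radial log-volume**: with
weights `[(F_mod)_v:ℝ]/[F_mod:ℚ]` (`normalizedTensorWeight` at `|A| = 1`, here written out) a per-field change
`c` gives a weighted change `c` ([IUTchIV] Rmk 1.7.1 p.17). [claim: Mochizuki2012, status: disputed] -/
theorem sum_normalizedWeight_mul_const (degF : W → ℕ+) (c : ℝ) :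
    ∑ w, (degF w : ℝ) / (∑ w', (degF w' : ℝ)) * c = c := by
  have hD := sum_degF_ne_zero degF
  rw [← Finset.sum_mul, ← Finset.sum_div, div_self hD, one_mul]

/-- The `A`-fold tensor version of `sum_packetWeight_eq_half`: under `[K_v:(F_mod)_v]·[(F_mod)_v:ℝ] = 2` the
Rmk 3.1.1 (ii) tensor weights over an archimedean `v_ℚ` sum to `(1/2)^{|A|}`
(`Σ_{wA} 1/((Π_α degKF)·D^{|A|}) = (Σ_w 1/degKF w)^{|A|}/D^{|A|} = (D/2)^{|A|}/D^{|A|}`).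
[claim: Mochizuki2012, status: disputed] -/
theorem sum_packetWeightTensor_eq_half_pow {A : Type v} [Fintype A] [DecidableEq A] (degF degKF : W → ℕ+)
    (h2 : ∀ w, (degKF w : ℝ) * (degF w : ℝ) = 2) :
    ∑ wA : A → W, packetWeightTensor degF degKF wA = (1 / 2) ^ Fintype.card A := by
  have hD := sum_degF_ne_zero degF
  set D : ℝ := ∑ w, (degF w : ℝ) with hDdef
  have hS : (∑ w' : A → W, ∏ a, (degF (w' a) : ℝ)) = D ^ Fintype.card A := sum_prod_degF_eq_pow degF
  -- each tensor weight is the product over `α` of `degF (wA α) / (2 D)`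
  have hterm : ∀ wA : A → W,
      packetWeightTensor degF degKF wA = ∏ a, ((degF (wA a) : ℝ) / (2 * D)) := by
    intro wA
    unfold packetWeightTensor
    rw [hS]
    have hk : ∀ a, (degKF (wA a) : ℝ) ≠ 0 := fun a => by exact_mod_cast (degKF (wA a)).pos.ne'
    have hprod : (∏ a, (degKF (wA a) : ℝ)) = ∏ a, (2 / (degF (wA a) : ℝ)) := by
      refine Finset.prod_congr rfl fun a _ => ?_
      have hf : (degF (wA a) : ℝ) ≠ 0 := by exact_mod_cast (degF (wA a)).pos.ne'
      rw [eq_div_iff hf, h2]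
    rw [hprod, Finset.prod_div_distrib, Finset.prod_div_distrib, Finset.prod_const, Finset.prod_const,
      Finset.card_univ, mul_pow]
    have hF : (∏ a, (degF (wA a) : ℝ)) ≠ 0 :=
      Finset.prod_ne_zero_iff.mpr fun a _ => by exact_mod_cast (degF (wA a)).pos.ne'
    have h2n : (2 : ℝ) ^ Fintype.card A ≠ 0 := pow_ne_zero _ two_ne_zero
    have hDn : D ^ Fintype.card A ≠ 0 := pow_ne_zero _ hD
    field_simp
  simp_rw [hterm]
  rw [← Fintype.prod_sum fun (_ : A) (w : W) => (degF w : ℝ) / (2 * D)]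
  rw [Finset.prod_const, Finset.card_univ]
  congr 1
  rw [← Finset.sum_div, ← hDdef]
  field_simp

end ArchimedeanHalf

end Literature.IUT.LogThetaLattice
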